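import Summits.Ventures.LatticeQCDFlow.Exactness.FlowSamplerSymmetrisation
import Summits.Ventures.LatticeQCDFlow.Exactness.Phi4FlowSymmetricMagnetisationExact
import Summits.Ventures.LatticeQCDFlow.Exactness.Phi4FlowSquareIntegrableSticking
import Summits.Ventures.LatticeQCDFlow.Exactness.Phi4FlowSquareIntegrableCeiling
import HarnessLib

/-!
# Row 2's FLOW ARM, SYMMETRISED: for EVERY network, flipping the sign of the proposal with probability ½ lowers the magnetisation's autocorrelation AT EVERY LAG, never lowers acceptance or ESS, and makes `τ_int(M) = ½ + S_M` exact

HONEST FRAMING: exact (Metropolis-corrected) sampling algorithms for lattice gauge theory;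
figures of merit are autocorrelation/cost numbers at stated couplings and volumes; no
continuum-physics claim.  (SCALAR calibration rung S0-A: not a gauge result.)

Venture `LatticeQCDFlow` (cell pub-lqcd), topic `Exactness`; FANOUT row 2 (`s0-phi4`, FLOW arm
`K = imhOpPhi4 J λ q̃`, every `λ > 0`, real `J`, EVERY positive measurable model density with
`∫ q̃ = 1` — no symmetry, no moment hypothesis on the network).  NEW WORK of the cell: the lattice
instances of `FlowSamplerSymmetrisation` (σ = `φ ↦ −φ`, a measure-preserving involution of Lebesgue
measure on `ℝ^Λ`; the φ⁴ weight is even, `gibbsWeight_neg`) composed with the all-lag sticking floors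
of `Phi4FlowSquareIntegrableSticking` and the exactness of `Phi4FlowSymmetricMagnetisationExact`.  The
symmetrised flow arm proposes `φ' ∼ q̃` and replaces it by `−φ'` with probability ½; its model density is
`q̃ₛ(φ) = ½(q̃(φ) + q̃(−φ))` (one extra network density evaluation per proposal).  Nothing is cited.

## What is proved (`Λ = Fin (n+1)`; `r`, `rₛ` the rejection probabilities of the flow arm and of the
symmetrised flow arm; `M = Σ_x φ_x`, `M̃ = M − ⟨M⟩ = M`; `ρ_M`, `ρₛ_M` the normalised autocorrelations)

* §0 (general space) `pow_le_midpoint`, **`symmetrised_stickingMoment_le`** — for `g² ∘ σ = g²` and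
  every `k`: `∫ g² w rₛᵏ ≤ ∫ g² w rᵏ` (pointwise `rₛ ≤ ½(r + r∘σ)` and convexity of `t ↦ tᵏ`).
* §1 **`phi4FlowSym_meanRejection_le`** — `∫ rₛ e^{−S} ≤ ∫ r e^{−S}`: acceptance never drops;
  **`phi4FlowSym_weightMoment_le`** — `∫ e^{−2S}/q̃ₛ ≤ ∫ e^{−2S}/q̃`: the flow's ESS never drops.
* §2 **`phi4FlowSym_autocorr_magnetisation_le`** — AT EVERY LAG `k ≥ 1` and for every network:
  `ρₛ_M(k) = E_{M̃²}[rₛᵏ]/Var M ≤ E_{M̃²}[rᵏ]/Var M ≤ ρ_M(k)` (exactness of the symmetrised arm, the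
  moment comparison, the sticking floor of the original arm);
* §3 **`phi4FlowSym_tauInt_magnetisation_le`** — if the original arm's autocorrelation series of `M`
  is summable then so is the symmetrised arm's, **`τ_intₛ(M) ≤ τ_int(M)`**, and
  `τ_intₛ(M) = ½ + S_M(q̃ₛ)` exactly with `S_M(q̃ₛ) ≤ S_M(q̃) < ∞`.

Reading for S0-A (no numerics implied): among exact flow samplers for an even action, the
`Z₂`-symmetrised proposal is never worse for the magnetisation, lag by lag, at the price of one extra
density evaluation; and for it the one-column bracket collapses to the equality `τ_int(M) = ½ + S_M`.
NOT CLAIMED: any value of `r`, `rₛ`, `S` for any network; that the per-cost figure of merit improves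
(density evaluations double); anything for even observables beyond §1; anything for HMC / local arms;
optimality among `Z₂` devices — composing ANY exact sampler of the even target with the free global
flip `φ ↦ −φ` (accepted with probability one) re-randomises the sign at every step and kills every odd
autocorrelation at lags `≥ 1` (then `M` says nothing about the sampler); proposal symmetrisation is
the device under which `M` remains a figure of merit of the flow itself while provably not worsening,
and whose even-sector gains (acceptance, ESS) are the ones that survive the flip trick.
-/

namespace Summit.Ventures.LatticeQCDFlow.Exactness

open Real MeasureTheory Filter Finset Set Topology
open Summit.Ventures.LatticeQCDFlow.Scoring

/-! ## §0 General space: every sticking moment of the symmetrised sampler is smaller -/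

section General

variable {X : Type*} [MeasurableSpace X] {μ : Measure X} [SFinite μ] {w q : X → ℝ} {σ : X → X}

/-- Midpoint convexity of `t ↦ tᵏ` on `[0, ∞)`: `0 ≤ m ≤ (a + b)/2` ⇒ `mᵏ ≤ (aᵏ + bᵏ)/2`. -/
theorem pow_le_midpoint {a b m : ℝ} (ha : 0 ≤ a) (hb : 0 ≤ b) (hm0 : 0 ≤ m) (hm : m ≤ (a + b) / 2)
    (k : ℕ) : m ^ k ≤ (a ^ k + b ^ k) / 2 := by
  have h := (convexOn_pow k).2 (Set.mem_Ici.2 ha) (Set.mem_Ici.2 hb) (by norm_num : (0:ℝ) ≤ 1 / 2)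
    (by norm_num : (0:ℝ) ≤ 1 / 2) (by norm_num)
  simp only [smul_eq_mul] at h
  calc m ^ k ≤ ((a + b) / 2) ^ k := pow_le_pow_left₀ hm0 hm k
    _ = (1 / 2 * a + 1 / 2 * b) ^ k := by ring
    _ ≤ 1 / 2 * a ^ k + 1 / 2 * b ^ k := h
    _ = (a ^ k + b ^ k) / 2 := by ring

/-- **EVERY STICKING MOMENT NEVER INCREASES UNDER SYMMETRISATION**: `σ` a measure-preserving
involution, `w ∘ σ = w`, `q̃ > 0` normalised, `g` measurable with `∫ g² w < ∞` and `g² ∘ σ = g²`; then for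
every `k`, `∫ g² w r_{q̃ₛ}ᵏ ≤ ∫ g² w r_q̃ᵏ` (`r_{q̃ₛ} ≤ ½(r_q̃ + r_q̃∘σ)` pointwise,
`FlowSamplerSymmetrisation.symmetrised_rejection_le`, and `t ↦ tᵏ` convex on `[0, ∞)`). -/
theorem symmetrised_stickingMoment_le (hσ : MeasurePreserving σ μ μ) (hσσ : ∀ x, σ (σ x) = x)
    (hw0 : ∀ t, 0 < w t) (hwm : Measurable w) (hw : ∀ t, w (σ t) = w t) (hq0 : ∀ t, 0 < q t)
    (hqm : Measurable q) (hqi : Integrable q μ) (hq1 : ∫ z, q z ∂μ = 1) {g : X → ℝ}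
    (hgm : Measurable g) (hg2 : Integrable (fun t => g t ^ 2 * w t) μ)
    (hg : ∀ t, g (σ t) ^ 2 = g t ^ 2) (k : ℕ) :
    ∫ x, g x ^ 2 * w x
        * (∫ z, (1 - imhAcceptQ w (fun t => (q t + q (σ t)) / 2) x z) * ((q z + q (σ z)) / 2) ∂μ) ^ k ∂μ
      ≤ ∫ x, g x ^ 2 * w x * (∫ z, (1 - imhAcceptQ w q x z) * q z ∂μ) ^ k ∂μ := by
  obtain ⟨hs0, hsm, hsi, hs1, -⟩ := symmetrised_facts hσ hσσ hq0 hqm hqi hq1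
  obtain ⟨hr0, hr1, hrm⟩ := rejection_bounds (μ := μ) hw0 hwm hq0 hqm hqi hq1
  obtain ⟨hs0', hs1', hsm'⟩ := rejection_bounds (μ := μ) hw0 hwm hs0 hsm hsi hs1
  set r : X → ℝ := fun x => ∫ z, (1 - imhAcceptQ w q x z) * q z ∂μ with hr
  set rs : X → ℝ := fun x => ∫ z, (1 - imhAcceptQ w (fun t => (q t + q (σ t)) / 2) x z)
    * ((q z + q (σ z)) / 2) ∂μ with hrs
  have hgw0 : ∀ x, 0 ≤ g x ^ 2 * w x := fun x => mul_nonneg (sq_nonneg _) (hw0 x).le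
  set A : X → ℝ := fun x => g x ^ 2 * w x * r x ^ k with hA
  have hAi : Integrable A μ := by
    refine Integrable.mono' hg2 (((hgm.pow_const 2).mul hwm).mul (hrm.pow_const k)).aestronglyMeasurable
      (Eventually.of_forall fun x => ?_)
    rw [Real.norm_eq_abs, abs_of_nonneg (mul_nonneg (hgw0 x) (pow_nonneg (hr0 x) k))]
    exact mul_le_of_le_one_right (hgw0 x) (pow_le_one₀ (hr0 x) (hr1 x))
  have hAσ : Integrable (fun x => A (σ x)) μ := integrable_comp_involution hσ hσσ hAi
  have hAσ_eq : ∀ x, A (σ x) = g x ^ 2 * w x * r (σ x) ^ k := fun x => by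
    show g (σ x) ^ 2 * w (σ x) * r (σ x) ^ k = g x ^ 2 * w x * r (σ x) ^ k
    rw [hg x, hw x]
  have hσint : ∫ x, A (σ x) ∂μ = ∫ x, A x ∂μ := integral_comp_involution hσ hσσ A
  have hpt : ∀ x, g x ^ 2 * w x * rs x ^ k ≤ (A x + A (σ x)) / 2 := fun x => by
    rw [hAσ_eq x]
    have hpow := pow_le_midpoint (hr0 x) (hr0 (σ x)) (hs0' x)
      (symmetrised_rejection_le hσ hσσ hw0 hwm hw hq0 hqm hqi hq1 x) k
    have e : (A x + g x ^ 2 * w x * r (σ x) ^ k) / 2 = g x ^ 2 * w x * ((r x ^ k + r (σ x) ^ k) / 2) := by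
      simp only [hA]
      ring
    rw [e]
    exact mul_le_mul_of_nonneg_left hpow (hgw0 x)
  have hint : Integrable (fun x => g x ^ 2 * w x * rs x ^ k) μ := by
    refine Integrable.mono' hg2 (((hgm.pow_const 2).mul hwm).mul (hsm'.pow_const k)).aestronglyMeasurable
      (Eventually.of_forall fun x => ?_)
    rw [Real.norm_eq_abs, abs_of_nonneg (mul_nonneg (hgw0 x) (pow_nonneg (hs0' x) k))]
    exact mul_le_of_le_one_right (hgw0 x) (pow_le_one₀ (hs0' x) (hs1' x))
  calc ∫ x, g x ^ 2 * w x * rs x ^ k ∂μ ≤ ∫ x, (A x + A (σ x)) / 2 ∂μ :=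
        integral_mono hint ((hAi.add hAσ).div_const 2) hpt
    _ = ∫ x, A x ∂μ := by
        rw [integral_div, integral_add hAi hAσ, hσint]
        ring

end General

/-! ## §1 The lattice: acceptance and effective sample size -/

section Lattice

variable {n : ℕ}

/-- Negation is a measure-preserving involution of Lebesgue measure on `ℝ^Λ`. -/
theorem measurePreserving_neg_pi : MeasurePreserving (fun φ : Fin (n + 1) → ℝ => -φ) volume volume := by
  haveI := isNegInvariant_volume_pi (Λ := Fin (n + 1))
  exact Measure.measurePreserving_neg volume

/-- **THE SYMMETRISED FLOW ARM NEVER REJECTS MORE ON AVERAGE**: for every `λ > 0`, real `J` and every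
positive model density `q̃`, `∫ rₛ(φ) e^{−S(φ)} dφ ≤ ∫ r(φ) e^{−S(φ)} dφ` (`ā = 1 − ∫ r e^{−S}/Z`). -/
theorem phi4FlowSym_meanRejection_le {lam : ℝ} (hlam : 0 < lam)
    (J : Fin (n + 1) → Fin (n + 1) → ℝ) {q : (Fin (n + 1) → ℝ) → ℝ} (hq0 : ∀ φ, 0 < q φ)
    (hqm : Measurable q) (hqi : Integrable q) (hq1 : ∫ φ, q φ = 1) :
    ∫ φ, (∫ φ', (1 - imhAcceptQ (gibbsWeight J lam) (fun ψ => (q ψ + q (-ψ)) / 2) φ φ')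
          * ((q φ' + q (-φ')) / 2)) * gibbsWeight J lam φ
      ≤ ∫ φ, (∫ φ', (1 - imhAcceptQ (gibbsWeight J lam) q φ φ') * q φ') * gibbsWeight J lam φ :=
  symmetrised_meanRejection_le (μ := volume) (σ := fun ψ : Fin (n + 1) → ℝ => -ψ)
    measurePreserving_neg_pi (fun φ => neg_neg φ) (fun φ => gibbsWeight_pos J lam φ)
    (continuous_gibbsWeight J lam).measurable (integrable_gibbsWeight hlam J)
    (fun φ => gibbsWeight_neg J lam φ) hq0 hqm hqi hq1

/-- **THE SYMMETRISED FLOW'S IMPORTANCE-WEIGHT MOMENT IS NO LARGER**: `W₂(q̃) = ∫ (e^{−S}/q̃) e^{−S} < ∞`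
⇒ `W₂(q̃ₛ) ≤ W₂(q̃)` (finite): the i.i.d. effective sample size `Z²/W₂` of the symmetrised flow is at
least that of the flow (every real `J`, `λ`). -/
theorem phi4FlowSym_weightMoment_le (J : Fin (n + 1) → Fin (n + 1) → ℝ) (lam : ℝ)
    {q : (Fin (n + 1) → ℝ) → ℝ} (hq0 : ∀ φ, 0 < q φ) (hqm : Measurable q)
    (hW : Integrable (fun φ => gibbsWeight J lam φ / q φ * gibbsWeight J lam φ)) :
    Integrable (fun φ => gibbsWeight J lam φ / ((q φ + q (-φ)) / 2) * gibbsWeight J lam φ) ∧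
    ∫ φ, gibbsWeight J lam φ / ((q φ + q (-φ)) / 2) * gibbsWeight J lam φ
      ≤ ∫ φ, gibbsWeight J lam φ / q φ * gibbsWeight J lam φ :=
  symmetrised_weightMoment_le (μ := volume) (σ := fun ψ : Fin (n + 1) → ℝ => -ψ)
    measurePreserving_neg_pi (fun φ => neg_neg φ) (fun φ => gibbsWeight_pos J lam φ)
    (continuous_gibbsWeight J lam).measurable (fun φ => gibbsWeight_neg J lam φ) hq0 hqm hW

/-! ## §2 The magnetisation, lag by lag -/

/-- The centred magnetisation is odd: `M̃(−φ) = −M̃(φ)` (`⟨M⟩ = 0`). -/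
theorem magnetisation_sub_gibbsExpect_neg (J : Fin (n + 1) → Fin (n + 1) → ℝ) (lam : ℝ)
    (φ : Fin (n + 1) → ℝ) :
    (∑ x, (-φ) x) - gibbsExpect J lam (fun ψ => ∑ x, ψ x)
      = -((∑ x, φ x) - gibbsExpect J lam (fun ψ => ∑ x, ψ x)) := by
  simp only [Pi.neg_apply, Finset.sum_neg_distrib, gibbsExpect_magnetisation]
  ring

/-- **EVERY STICKING MOMENT OF THE MAGNETISATION IS SMALLER FOR THE SYMMETRISED ARM**:
`∫ M̃² e^{−S} rₛᵏ ≤ ∫ M̃² e^{−S} rᵏ` for every `k` and every network. -/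
theorem phi4FlowSym_stickingMoment_magnetisation_le {lam : ℝ} (hlam : 0 < lam)
    (J : Fin (n + 1) → Fin (n + 1) → ℝ) {q : (Fin (n + 1) → ℝ) → ℝ} (hq0 : ∀ φ, 0 < q φ)
    (hqm : Measurable q) (hqi : Integrable q) (hq1 : ∫ φ, q φ = 1) (k : ℕ) :
    ∫ φ, ((∑ x, φ x) - gibbsExpect J lam (fun ψ => ∑ x, ψ x)) ^ 2 * gibbsWeight J lam φ
        * (∫ φ', (1 - imhAcceptQ (gibbsWeight J lam) (fun ψ => (q ψ + q (-ψ)) / 2) φ φ')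
            * ((q φ' + q (-φ')) / 2)) ^ k
      ≤ ∫ φ, ((∑ x, φ x) - gibbsExpect J lam (fun ψ => ∑ x, ψ x)) ^ 2 * gibbsWeight J lam φ
        * (∫ φ', (1 - imhAcceptQ (gibbsWeight J lam) q φ φ') * q φ') ^ k := by
  obtain ⟨hgm, hg2⟩ := polyObs_sq_integrable hlam J
    (polyObs_sub_const polyObs_magnetisation (gibbsExpect J lam (fun ψ => ∑ x, ψ x)))
  exact symmetrised_stickingMoment_le (μ := volume) (σ := fun ψ : Fin (n + 1) → ℝ => -ψ)
    measurePreserving_neg_pi (fun φ => neg_neg φ) (fun φ => gibbsWeight_pos J lam φ)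
    (continuous_gibbsWeight J lam).measurable (fun φ => gibbsWeight_neg J lam φ) hq0 hqm hqi hq1 hgm hg2
    (fun φ => by rw [magnetisation_sub_gibbsExpect_neg, neg_sq]) k

/-- **LAG BY LAG, THE SYMMETRISED FLOW ARM DECORRELATES THE MAGNETISATION AT LEAST AS FAST.**  Every
`λ > 0`, real `J`, EVERY positive measurable model density with `∫ q̃ = 1`, every lag `k`:
`ρₛ_M(k+1) ≤ ρ_M(k+1)` — the left side IS `E_{M̃²}[rₛ^{k+1}]/Var M`
(`phi4Flow_autocorr_magnetisation_eq_sticking_symmetrised`), which is at most `E_{M̃²}[r^{k+1}]/Var M`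
(§0), which floors the right side (`phi4Flow_autocorr_ge_sticking_magnetisation`). -/
theorem phi4FlowSym_autocorr_magnetisation_le {lam : ℝ} (hlam : 0 < lam)
    (J : Fin (n + 1) → Fin (n + 1) → ℝ) {q : (Fin (n + 1) → ℝ) → ℝ} (hq0 : ∀ φ, 0 < q φ)
    (hqm : Measurable q) (hqi : Integrable q) (hq1 : ∫ φ, q φ = 1) (k : ℕ) :
    (∫ φ, ((∑ x, φ x) - gibbsExpect J lam (fun ψ => ∑ x, ψ x))
        * ((imhOpPhi4 J lam (fun ψ => (q ψ + q (-ψ)) / 2))^[k + 1]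
            (fun ψ => (∑ x, ψ x) - gibbsExpect J lam (fun ψ => ∑ x, ψ x))) φ * gibbsWeight J lam φ)
        / ∫ φ, ((∑ x, φ x) - gibbsExpect J lam (fun ψ => ∑ x, ψ x)) ^ 2 * gibbsWeight J lam φ
      ≤ (∫ φ, ((∑ x, φ x) - gibbsExpect J lam (fun ψ => ∑ x, ψ x))
          * ((imhOpPhi4 J lam q)^[k + 1]
              (fun ψ => (∑ x, ψ x) - gibbsExpect J lam (fun ψ => ∑ x, ψ x))) φ * gibbsWeight J lam φ)
        / ∫ φ, ((∑ x, φ x) - gibbsExpect J lam (fun ψ => ∑ x, ψ x)) ^ 2 * gibbsWeight J lam φ := by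
  rw [phi4Flow_autocorr_magnetisation_eq_sticking_symmetrised hlam J hq0 hqm hqi hq1 (k + 1)]
  refine le_trans ?_ (phi4Flow_autocorr_ge_sticking_magnetisation hlam J hq0 hqm hqi hq1 k)
  exact div_le_div_of_nonneg_right
    (phi4FlowSym_stickingMoment_magnetisation_le hlam J hq0 hqm hqi hq1 (k + 1))
    (integral_nonneg fun φ => mul_nonneg (sq_nonneg _) (gibbsWeight_pos J lam φ).le)

/-! ## §3 The magnetisation's integrated autocorrelation time -/

/-- **SYMMETRISING NEVER INCREASES `τ_int(M)`, AND MAKES IT EXACT.**  Every `λ > 0`, real `J`, every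
positive measurable model density with `∫ q̃ = 1`.  If the magnetisation's normalised autocorrelation
series under the flow arm `imhOpPhi4 J λ q̃` is summable, then under the symmetrised arm
`imhOpPhi4 J λ q̃ₛ` it is summable too, **`τ_intₛ(M) ≤ τ_int(M)`** (termwise domination, §2), the
sticking column is finite, `S_M(q̃ₛ) ≤ S_M(q̃) < ∞`, and **`τ_intₛ(M) = ½ + S_M(q̃ₛ)`** exactly. -/
theorem phi4FlowSym_tauInt_magnetisation_le {lam : ℝ} (hlam : 0 < lam)
    (J : Fin (n + 1) → Fin (n + 1) → ℝ) {q : (Fin (n + 1) → ℝ) → ℝ} (hq0 : ∀ φ, 0 < q φ)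
    (hqm : Measurable q) (hqi : Integrable q) (hq1 : ∫ φ, q φ = 1)
    (hs : Summable fun k => (∫ φ, ((∑ x, φ x) - gibbsExpect J lam (fun ψ => ∑ x, ψ x))
        * ((imhOpPhi4 J lam q)^[k + 1]
            (fun ψ => (∑ x, ψ x) - gibbsExpect J lam (fun ψ => ∑ x, ψ x))) φ * gibbsWeight J lam φ)
        / ∫ φ, ((∑ x, φ x) - gibbsExpect J lam (fun ψ => ∑ x, ψ x)) ^ 2 * gibbsWeight J lam φ) :
    (Summable fun k => (∫ φ, ((∑ x, φ x) - gibbsExpect J lam (fun ψ => ∑ x, ψ x))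
        * ((imhOpPhi4 J lam (fun ψ => (q ψ + q (-ψ)) / 2))^[k + 1]
            (fun ψ => (∑ x, ψ x) - gibbsExpect J lam (fun ψ => ∑ x, ψ x))) φ * gibbsWeight J lam φ)
        / ∫ φ, ((∑ x, φ x) - gibbsExpect J lam (fun ψ => ∑ x, ψ x)) ^ 2 * gibbsWeight J lam φ) ∧
    tauInt (fun k => (∫ φ, ((∑ x, φ x) - gibbsExpect J lam (fun ψ => ∑ x, ψ x))
        * ((imhOpPhi4 J lam (fun ψ => (q ψ + q (-ψ)) / 2))^[k]
            (fun ψ => (∑ x, ψ x) - gibbsExpect J lam (fun ψ => ∑ x, ψ x))) φ * gibbsWeight J lam φ)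
        / ∫ φ, ((∑ x, φ x) - gibbsExpect J lam (fun ψ => ∑ x, ψ x)) ^ 2 * gibbsWeight J lam φ)
      ≤ tauInt (fun k => (∫ φ, ((∑ x, φ x) - gibbsExpect J lam (fun ψ => ∑ x, ψ x))
        * ((imhOpPhi4 J lam q)^[k]
            (fun ψ => (∑ x, ψ x) - gibbsExpect J lam (fun ψ => ∑ x, ψ x))) φ * gibbsWeight J lam φ)
        / ∫ φ, ((∑ x, φ x) - gibbsExpect J lam (fun ψ => ∑ x, ψ x)) ^ 2 * gibbsWeight J lam φ) ∧
    Integrable (fun φ : Fin (n + 1) → ℝ =>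
      ((∑ x, φ x) - gibbsExpect J lam (fun ψ => ∑ x, ψ x)) ^ 2 * gibbsWeight J lam φ
        * ((∫ φ', (1 - imhAcceptQ (gibbsWeight J lam) (fun ψ => (q ψ + q (-ψ)) / 2) φ φ')
              * ((q φ' + q (-φ')) / 2))
          / (1 - ∫ φ', (1 - imhAcceptQ (gibbsWeight J lam) (fun ψ => (q ψ + q (-ψ)) / 2) φ φ')
              * ((q φ' + q (-φ')) / 2)))) ∧
    tauInt (fun k => (∫ φ, ((∑ x, φ x) - gibbsExpect J lam (fun ψ => ∑ x, ψ x))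
        * ((imhOpPhi4 J lam (fun ψ => (q ψ + q (-ψ)) / 2))^[k]
            (fun ψ => (∑ x, ψ x) - gibbsExpect J lam (fun ψ => ∑ x, ψ x))) φ * gibbsWeight J lam φ)
        / ∫ φ, ((∑ x, φ x) - gibbsExpect J lam (fun ψ => ∑ x, ψ x)) ^ 2 * gibbsWeight J lam φ)
      = 1 / 2 + (∫ φ, ((∑ x, φ x) - gibbsExpect J lam (fun ψ => ∑ x, ψ x)) ^ 2 * gibbsWeight J lam φ
          * ((∫ φ', (1 - imhAcceptQ (gibbsWeight J lam) (fun ψ => (q ψ + q (-ψ)) / 2) φ φ')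
                * ((q φ' + q (-φ')) / 2))
            / (1 - ∫ φ', (1 - imhAcceptQ (gibbsWeight J lam) (fun ψ => (q ψ + q (-ψ)) / 2) φ φ')
                * ((q φ' + q (-φ')) / 2))))
        / ∫ φ, ((∑ x, φ x) - gibbsExpect J lam (fun ψ => ∑ x, ψ x)) ^ 2 * gibbsWeight J lam φ := by
  obtain ⟨hs0, hsm, hsi, hs1, hsym⟩ := symmetrisedDensity_facts hq0 hqm hqi hq1
  -- termwise: `0 ≤ ρₛ(k+1) ≤ ρ(k+1)`
  have hle : ∀ k, (∫ φ, ((∑ x, φ x) - gibbsExpect J lam (fun ψ => ∑ x, ψ x))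
        * ((imhOpPhi4 J lam (fun ψ => (q ψ + q (-ψ)) / 2))^[k + 1]
            (fun ψ => (∑ x, ψ x) - gibbsExpect J lam (fun ψ => ∑ x, ψ x))) φ * gibbsWeight J lam φ)
        / ∫ φ, ((∑ x, φ x) - gibbsExpect J lam (fun ψ => ∑ x, ψ x)) ^ 2 * gibbsWeight J lam φ
      ≤ (∫ φ, ((∑ x, φ x) - gibbsExpect J lam (fun ψ => ∑ x, ψ x))
          * ((imhOpPhi4 J lam q)^[k + 1]
              (fun ψ => (∑ x, ψ x) - gibbsExpect J lam (fun ψ => ∑ x, ψ x))) φ * gibbsWeight J lam φ)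
        / ∫ φ, ((∑ x, φ x) - gibbsExpect J lam (fun ψ => ∑ x, ψ x)) ^ 2 * gibbsWeight J lam φ :=
    fun k => phi4FlowSym_autocorr_magnetisation_le hlam J hq0 hqm hqi hq1 k
  have hnn : ∀ k, 0 ≤ (∫ φ, ((∑ x, φ x) - gibbsExpect J lam (fun ψ => ∑ x, ψ x))
        * ((imhOpPhi4 J lam (fun ψ => (q ψ + q (-ψ)) / 2))^[k + 1]
            (fun ψ => (∑ x, ψ x) - gibbsExpect J lam (fun ψ => ∑ x, ψ x))) φ * gibbsWeight J lam φ)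
        / ∫ φ, ((∑ x, φ x) - gibbsExpect J lam (fun ψ => ∑ x, ψ x)) ^ 2 * gibbsWeight J lam φ := by
    intro k
    rw [phi4Flow_autocorr_magnetisation_eq_sticking_symmetrised hlam J hq0 hqm hqi hq1 (k + 1)]
    exact div_nonneg (integral_nonneg fun φ => mul_nonneg (mul_nonneg (sq_nonneg _)
      (gibbsWeight_pos J lam φ).le) (pow_nonneg ((rejection_bounds (μ := volume)
        (fun ψ => gibbsWeight_pos J lam ψ) (continuous_gibbsWeight J lam).measurable
        hs0 hsm hsi hs1).1 φ) _))
      (integral_nonneg fun φ => mul_nonneg (sq_nonneg _) (gibbsWeight_pos J lam φ).le)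
  have hss : Summable fun k => (∫ φ, ((∑ x, φ x) - gibbsExpect J lam (fun ψ => ∑ x, ψ x))
        * ((imhOpPhi4 J lam (fun ψ => (q ψ + q (-ψ)) / 2))^[k + 1]
            (fun ψ => (∑ x, ψ x) - gibbsExpect J lam (fun ψ => ∑ x, ψ x))) φ * gibbsWeight J lam φ)
        / ∫ φ, ((∑ x, φ x) - gibbsExpect J lam (fun ψ => ∑ x, ψ x)) ^ 2 * gibbsWeight J lam φ :=
    Summable.of_nonneg_of_le hnn hle hs
  have hS := phi4Flow_integrable_stickingOdds_magnetisation_of_summable hlam J hs0 hsm hsi hs1 hss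
  obtain ⟨-, heq⟩ := phi4Flow_tauInt_magnetisation_eq hlam J hs0 hsm hsi hs1 hsym hS
  refine ⟨hss, ?_, hS, heq⟩
  unfold tauInt
  have ht := Summable.tsum_le_tsum hle hss hs
  linarith

/-! ## §4 Under a Gaussian minorant of the model: unconditional -/

/-- A Gaussian minorant of the model density is inherited by its symmetrisation (`Σ(−φ)² = Σφ²`). -/
theorem symmetrisedDensity_gaussian_minorant {q : (Fin (n + 1) → ℝ) → ℝ} {c κ : ℝ}
    (hqc : ∀ φ, c * Real.exp (-(κ * ∑ w, φ w ^ 2)) ≤ q φ) (φ : Fin (n + 1) → ℝ) :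
    c * Real.exp (-(κ * ∑ w, φ w ^ 2)) ≤ (q φ + q (-φ)) / 2 := by
  have h1 := hqc φ
  have h2 := hqc (-φ)
  simp only [Pi.neg_apply, neg_sq] at h2
  linarith

/-- **UNCONDITIONALLY FOR AFFINE-COUPLING FLOWS WITH BOUNDED LOG-SCALES** (a Gaussian minorant
`q̃ ≥ c e^{−κΣφ²}`, `c > 0`, as in `Phi4FlowSamplerGaussianMinorant`): the flow arm's magnetisation
series is summable (`Phi4FlowSquareIntegrableCeiling`), hence so is the symmetrised arm's, and
**`τ_intₛ(M) = ½ + S_M(q̃ₛ) ≤ τ_int(M) ≤ e^{K}/(cZ) − ½`**, `K = (n+1)(Σ|J| + κ)²/(4λ)` — all finite. -/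
theorem phi4FlowSym_tauInt_magnetisation_le_of_gaussian_minorant {lam : ℝ} (hlam : 0 < lam)
    (J : Fin (n + 1) → Fin (n + 1) → ℝ) {q : (Fin (n + 1) → ℝ) → ℝ} (hq0 : ∀ φ, 0 < q φ)
    (hqm : Measurable q) (hqi : Integrable q) (hq1 : ∫ φ, q φ = 1)
    {c κ : ℝ} (hc : 0 < c) (hqc : ∀ φ, c * Real.exp (-(κ * ∑ w, φ w ^ 2)) ≤ q φ) :
    (Summable fun k => (∫ φ, ((∑ x, φ x) - gibbsExpect J lam (fun ψ => ∑ x, ψ x))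
        * ((imhOpPhi4 J lam (fun ψ => (q ψ + q (-ψ)) / 2))^[k + 1]
            (fun ψ => (∑ x, ψ x) - gibbsExpect J lam (fun ψ => ∑ x, ψ x))) φ * gibbsWeight J lam φ)
        / ∫ φ, ((∑ x, φ x) - gibbsExpect J lam (fun ψ => ∑ x, ψ x)) ^ 2 * gibbsWeight J lam φ) ∧
    tauInt (fun k => (∫ φ, ((∑ x, φ x) - gibbsExpect J lam (fun ψ => ∑ x, ψ x))
        * ((imhOpPhi4 J lam (fun ψ => (q ψ + q (-ψ)) / 2))^[k]
            (fun ψ => (∑ x, ψ x) - gibbsExpect J lam (fun ψ => ∑ x, ψ x))) φ * gibbsWeight J lam φ)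
        / ∫ φ, ((∑ x, φ x) - gibbsExpect J lam (fun ψ => ∑ x, ψ x)) ^ 2 * gibbsWeight J lam φ)
      ≤ tauInt (fun k => (∫ φ, ((∑ x, φ x) - gibbsExpect J lam (fun ψ => ∑ x, ψ x))
        * ((imhOpPhi4 J lam q)^[k]
            (fun ψ => (∑ x, ψ x) - gibbsExpect J lam (fun ψ => ∑ x, ψ x))) φ * gibbsWeight J lam φ)
        / ∫ φ, ((∑ x, φ x) - gibbsExpect J lam (fun ψ => ∑ x, ψ x)) ^ 2 * gibbsWeight J lam φ) ∧
    tauInt (fun k => (∫ φ, ((∑ x, φ x) - gibbsExpect J lam (fun ψ => ∑ x, ψ x))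
        * ((imhOpPhi4 J lam q)^[k]
            (fun ψ => (∑ x, ψ x) - gibbsExpect J lam (fun ψ => ∑ x, ψ x))) φ * gibbsWeight J lam φ)
        / ∫ φ, ((∑ x, φ x) - gibbsExpect J lam (fun ψ => ∑ x, ψ x)) ^ 2 * gibbsWeight J lam φ)
      ≤ Real.exp ((n + 1) * (((∑ y, ∑ z, |J y z|) + κ) ^ 2 / (4 * lam))) / c / gibbsZ J lam
        - 1 / 2 := by
  obtain ⟨hs, hceil⟩ := phi4Flow_tauInt_le_magnetisation_of_gaussian_minorant hlam J hq0 hqm hqi hq1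
    hc hqc
  obtain ⟨hss, hle, -, -⟩ := phi4FlowSym_tauInt_magnetisation_le hlam J hq0 hqm hqi hq1 hs
  exact ⟨hss, hle, hceil⟩

end Lattice

/-! ## §5 Caveat of record: the FREE global flip annihilates every odd autocorrelation

Why S0-A scores EVEN observables (`E`, `χ₂`, `G(0,0)`): composing ANY exact one-step operator `K` with
`K 0 = 0` (every Markov operator) with an independent fair flip `φ ↦ −φ` after each step — exact for an
even action, cost nil — gives the operator `f ↦ K(½(f + f∘σ))`, which kills odd `f` in one step.  So
`τ_int(M) = ½` is available for free to every sampler and the magnetisation measures nothing about a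
sampler that uses the flip; §§2–3 concern the flow arm WITHOUT it (the proposal-symmetrised arm still
rejects, and `M` stays informative: `ρₛ_M(k) = E_{M̃²}[rₛᵏ]/Var M`). -/

section Caveat

/-- For any operator `K` with `K 0 = 0`, the flip-composed iterates of an odd observable vanish. -/
theorem flipComposed_iterate_odd_eq_zero {X : Type*} {σ : X → X} (K : (X → ℝ) → (X → ℝ))
    (hK : K (fun _ => 0) = fun _ => 0) {f : X → ℝ} (hodd : ∀ x, f (σ x) = -f x) (k : ℕ) :
    (fun g => K (fun x => (g x + g (σ x)) / 2))^[k + 1] f = fun _ => 0 := by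
  induction k with
  | zero =>
      have e : (fun x => (f x + f (σ x)) / 2) = fun _ => 0 := by
        funext x; rw [hodd x]; ring
      simp only [zero_add, Function.iterate_one, e, hK]
  | succ k ih =>
      rw [Function.iterate_succ_apply', ih]
      have e : (fun x : X => ((fun _ => (0:ℝ)) x + (fun _ => (0:ℝ)) (σ x)) / 2) = fun _ => 0 := by
        funext x; simp
      rw [e, hK]

variable {n : ℕ}

/-- The flow arm's operator kills the zero observable (`∫ q̃`-weighted average of zeros). -/
theorem imhOpPhi4_zero (J : Fin (n + 1) → Fin (n + 1) → ℝ) (lam : ℝ) (q : (Fin (n + 1) → ℝ) → ℝ) :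
    imhOpPhi4 J lam q (fun _ => 0) = fun _ => 0 := by
  funext φ
  rw [imhOpPhi4_eq_imhOp]
  simp [imhOp]

/-- **THE FLOW ARM FOLLOWED BY A FAIR GLOBAL FLIP HAS ZERO MAGNETISATION AUTOCOVARIANCE AT EVERY LAG
`≥ 1`** (every `J`, `λ`, `q̃` — no hypothesis at all): `∫ M̃ · (K_flip^{k+1} M̃) e^{−S} = 0`. -/
theorem phi4FlowFlip_autocov_magnetisation_eq_zero (J : Fin (n + 1) → Fin (n + 1) → ℝ) (lam : ℝ)
    (q : (Fin (n + 1) → ℝ) → ℝ) (k : ℕ) :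
    ∫ φ, ((∑ x, φ x) - gibbsExpect J lam (fun ψ => ∑ x, ψ x))
        * ((fun g => imhOpPhi4 J lam q (fun ψ : Fin (n + 1) → ℝ => (g ψ + g (-ψ)) / 2))^[k + 1]
            (fun ψ => (∑ x, ψ x) - gibbsExpect J lam (fun ψ => ∑ x, ψ x))) φ * gibbsWeight J lam φ
      = 0 := by
  rw [flipComposed_iterate_odd_eq_zero (σ := fun ψ : Fin (n + 1) → ℝ => -ψ) (imhOpPhi4 J lam q)
    (imhOpPhi4_zero J lam q) (magnetisation_sub_gibbsExpect_neg J lam) k]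
  simp

end Caveat

end Summit.Ventures.LatticeQCDFlow.Exactness
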